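import Summits.Schanuel.Schanuel.Theorems.ZilberEacBranchKernel
import Summits.Schanuel.Schanuel.Theorems.ZilberEacAlgebraicLogRelation
import Summits.Schanuel.Schanuel.Theorems.ZilberEacGraphExpTranscendence
import Summits.Schanuel.Schanuel.Theorems.ZilberEacQuadraticLogTranscendence
import Mathlib.Analysis.Complex.OpenMapping
import HarnessLib

/-!
# The equimodular class, XLVII: PARAMETRISED branches `t ↦ (γ(t), η(t))` of a fibre curve — the
# two-germ evaluation, its kernel, and the chain rule

HONEST FRAMING.  Cell `pub-schanuel` (Zilber's Exponential-Algebraic Closedness, case ladder;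
host summit Schanuel), seat 2, gen 25.  To push the transcendence of the logarithm of an algebraic
branch (file XLIII) past RAMIFIED zeros and poles, the branch of `Q = 0` through a singular point is
used in Puiseux-parametrised form `z = γ(t)` (`= a + t^e`), `y = η(t)`, both analytic in `t`.  This
file is the infrastructure: the evaluation `ℂ[s][t] → AGerm t₀`, `s ↦ germ γ`, `t ↦ germ η`
(**`eval₂Germ_mk`**), the transcendence of the germ of a non-constant analytic function
(**`transcendental_mk_of_deriv_ne_zero`**, by the open mapping theorem), the kernel lemma
**`dvd_of_eval₂Germ_eq_zero`** (an irreducible `Q` of positive `t`-degree killed by the evaluation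
divides everything it kills — Gauss's lemma over `ℂ[s]` and a cleared Bézout identity, as in file XL
but over the transcendental germ `γ̂` instead of `zGerm`), and the two-variable chain rule
**`hasDerivAt_evalPP₂`** with **`analyticAt_evalPP₂`**.  [folklore]; nothing here is specific to
Schanuel's conjecture (neither used nor implied).
-/

noncomputable section

open Filter Topology Polynomial

set_option linter.dupNamespace false

namespace Summit.Schanuel.Schanuel.Theorems

/-! ## Part A. Evaluating `P ∈ ℂ[s][t]` at `(γ(t), η(t))` -/

/-- `t ↦ P(γ t, η t)` is analytic when `γ, η` are. [folklore] -/
theorem analyticAt_evalPP₂ {t₀ : ℂ} {γ η : ℂ → ℂ} (hγ : AnalyticAt ℂ γ t₀) (hη : AnalyticAt ℂ η t₀)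
    (P : ℂ[X][X]) : AnalyticAt ℂ (fun t => (P.map (Polynomial.evalRingHom (γ t))).eval (η t)) t₀ := by
  have e : (fun t => (P.map (Polynomial.evalRingHom (γ t))).eval (η t)) =
      fun t => ∑ i ∈ Finset.range (P.natDegree + 1), (P.coeff i).eval (γ t) * η t ^ i := by
    funext t
    exact evalPP_eq_sum P (γ t) (η t) (Nat.lt_succ_self _)
  rw [e]
  exact Finset.analyticAt_fun_sum _ fun i _ => (analyticAt_polynomial_eval_comp hγ _).mul (hη.pow i)

/-- **The two-variable chain rule**: `(F(γ t, η t))' = ∂_sF·γ' + ∂_tF·η'`. [folklore] -/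
theorem hasDerivAt_evalPP₂ {γ η : ℂ → ℂ} {γ' η' t : ℂ} (hγ : HasDerivAt γ γ' t) (hη : HasDerivAt η η' t)
    (F : ℂ[X][X]) :
    HasDerivAt (fun y => (F.map (Polynomial.evalRingHom (γ y))).eval (η y))
      (((coeffDeriv F).map (Polynomial.evalRingHom (γ t))).eval (η t) * γ' +
        ((derivative F).map (Polynomial.evalRingHom (γ t))).eval (η t) * η') t := by
  set N := F.natDegree with hN
  have e : (fun y => (F.map (Polynomial.evalRingHom (γ y))).eval (η y)) =
      fun y => ∑ j ∈ Finset.range (N + 1), (F.coeff j).eval (γ y) * η y ^ j :=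
    funext fun y => evalPP_eq_sum F (γ y) (η y) (Nat.lt_succ_self _)
  have hderF : HasDerivAt (fun y => (F.map (Polynomial.evalRingHom (γ y))).eval (η y))
      (∑ j ∈ Finset.range (N + 1), ((derivative (F.coeff j)).eval (γ t) * γ' * η t ^ j +
        (F.coeff j).eval (γ t) * ((j : ℂ) * η t ^ (j - 1) * η'))) t := by
    rw [e]
    exact HasDerivAt.fun_sum fun j _ =>
      ((Polynomial.hasDerivAt (F.coeff j) (γ t)).comp t hγ).fun_mul (hη.fun_pow j)
  convert hderF using 1
  have hcD : (coeffDeriv F).natDegree < N + 1 := Nat.lt_succ_of_le (natDegree_coeffDeriv_le F)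
  have hder : (derivative F).natDegree < N + 1 :=
    Nat.lt_succ_of_le ((Polynomial.natDegree_derivative_le F).trans (Nat.sub_le _ _))
  rw [evalPP_eq_sum _ (γ t) (η t) hcD, evalPP_eq_sum _ (γ t) (η t) hder, Finset.sum_add_distrib,
    Finset.sum_mul, Finset.sum_mul]
  congr 1
  · refine Finset.sum_congr rfl fun j _ => ?_
    rw [coeff_coeffDeriv]
    ring
  · have hc : F.coeff (N + 1) = 0 := Polynomial.coeff_eq_zero_of_natDegree_lt (by omega)
    calc ∑ j ∈ Finset.range (N + 1), ((derivative F).coeff j).eval (γ t) * η t ^ j * η'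
        = ∑ j ∈ Finset.range (N + 1), ((j + 1 : ℕ) : ℂ) * (F.coeff (j + 1)).eval (γ t) * η t ^ j * η' := by
          refine Finset.sum_congr rfl fun j _ => ?_
          rw [Polynomial.coeff_derivative, Polynomial.eval_mul]
          simp only [Polynomial.eval_add, Polynomial.eval_natCast, Polynomial.eval_one]
          push_cast
          ring
      _ = (∑ j ∈ Finset.range (N + 1), ((j + 1 : ℕ) : ℂ) * (F.coeff (j + 1)).eval (γ t) * η t ^ j) * η' := by
          rw [Finset.sum_mul]
      _ = (∑ j ∈ Finset.range (N + 1), (j : ℂ) * (F.coeff j).eval (γ t) * η t ^ (j - 1)) * η' := by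
          rw [sum_succ_shift (fun j => (F.coeff j).eval (γ t)) (by rw [hc, Polynomial.eval_zero]) (η t)]
      _ = ∑ j ∈ Finset.range (N + 1), (F.coeff j).eval (γ t) * ((j : ℂ) * η t ^ (j - 1) * η') := by
          rw [Finset.sum_mul]
          refine Finset.sum_congr rfl fun j _ => ?_
          ring

/-- **The two-germ evaluation is the germ of the evaluated function**:
`(s ↦ germ γ, t ↦ germ η)(P) = germ (t ↦ P(γ t, η t))`. [folklore] -/
theorem eval₂Germ_mk {t₀ : ℂ} {γ η : ℂ → ℂ} (hγ : AnalyticAt ℂ γ t₀) (hη : AnalyticAt ℂ η t₀)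
    (P : ℂ[X][X]) :
    Polynomial.eval₂RingHom (Polynomial.eval₂RingHom (algebraMap ℂ (AGerm t₀)) (AGerm.mk t₀ hγ))
        (AGerm.mk t₀ hη) P =
      AGerm.mk t₀ (analyticAt_evalPP₂ hγ hη P) := by
  induction P using Polynomial.induction_on' with
  | add p q hp hq =>
    rw [map_add, hp, hq, ← AGerm.mk_add]
    exact AGerm.mk_congr _ _ fun z => by
      simp only [Pi.add_apply, Polynomial.map_add, Polynomial.eval_add]
  | monomial n r =>
    rw [Polynomial.coe_eval₂RingHom, Polynomial.eval₂_monomial, Polynomial.coe_eval₂RingHom,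
      ← Polynomial.aeval_def, aeval_mk hγ r (analyticAt_polynomial_eval_comp hγ r), ← AGerm.mk_pow,
      ← AGerm.mk_mul]
    exact AGerm.mk_congr _ _ fun z => by
      simp only [Pi.mul_apply, Pi.pow_apply, Polynomial.map_monomial, Polynomial.eval_monomial,
        Polynomial.coe_evalRingHom]

/-- `P(γ t, η t) = 0` near `t₀` iff the two-germ evaluation vanishes. [folklore] -/
theorem eval₂Germ_mk_eq_zero_iff {t₀ : ℂ} {γ η : ℂ → ℂ} (hγ : AnalyticAt ℂ γ t₀)
    (hη : AnalyticAt ℂ η t₀) (P : ℂ[X][X]) :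
    Polynomial.eval₂RingHom (Polynomial.eval₂RingHom (algebraMap ℂ (AGerm t₀)) (AGerm.mk t₀ hγ))
        (AGerm.mk t₀ hη) P = 0 ↔
      (fun t => (P.map (Polynomial.evalRingHom (γ t))).eval (η t)) =ᶠ[𝓝 t₀] 0 := by
  rw [eval₂Germ_mk, AGerm.mk_eq_zero_iff]

/-! ## Part B. The germ of a non-constant function is transcendental -/

/-- **The germ of an analytic function whose derivative does not vanish on a punctured
neighbourhood is transcendental over `ℂ`** (open mapping theorem: a nonzero polynomial cannot
vanish on a neighbourhood of `γ(t₀)`). [folklore] -/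
theorem transcendental_mk_of_deriv_ne_zero {t₀ : ℂ} {γ : ℂ → ℂ} (hγ : AnalyticAt ℂ γ t₀)
    (hγ' : ∀ᶠ t in 𝓝[≠] t₀, deriv γ t ≠ 0) : Transcendental ℂ (AGerm.mk t₀ hγ) := by
  rintro ⟨r, hr0, hr⟩
  rw [aeval_mk hγ r (analyticAt_polynomial_eval_comp hγ r), AGerm.mk_eq_zero_iff] at hr
  rcases hγ.eventually_constant_or_nhds_le_map_nhds with hconst | hopen
  · -- `γ` eventually constant: its derivative vanishes near `t₀`
    have hd : ∀ᶠ t in 𝓝 t₀, deriv γ t = 0 := by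
      filter_upwards [eventually_eventually_nhds.2 hconst] with t ht
      rw [Filter.EventuallyEq.deriv_eq (ht : γ =ᶠ[𝓝 t] fun _ => γ t₀), deriv_const]
    obtain ⟨t, ht, ht'⟩ := (hγ'.and (nhdsWithin_le_nhds hd)).exists
    exact ht ht'
  · -- open mapping: `r` vanishes on a neighbourhood of `γ t₀`
    have hmem : {w : ℂ | r.eval w = 0} ∈ 𝓝 (γ t₀) := by
      refine hopen ?_
      rw [Filter.mem_map]
      filter_upwards [hr] with t ht
      exact ht
    exact hr0 (Polynomial.eq_zero_of_eventually_eval_eq_zero (z₀ := γ t₀) hmem)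

/-! ## Part C. The kernel of the two-germ evaluation -/

/-- **The kernel of `ℂ[s][t] → AGerm t₀`, `s ↦ γ̂`, `t ↦ η̂`, with `γ̂` transcendental, is generated
by any irreducible member of positive `t`-degree.** [folklore] -/
theorem dvd_of_eval₂Germ_eq_zero {t₀ : ℂ} {u v : AGerm t₀} (hu : Transcendental ℂ u) {Q R : ℂ[X][X]}
    (hQirr : Irreducible Q) (hQ1 : Q.natDegree ≠ 0)
    (hQ : Polynomial.eval₂RingHom (Polynomial.eval₂RingHom (algebraMap ℂ (AGerm t₀)) u) v Q = 0)
    (hR : Polynomial.eval₂RingHom (Polynomial.eval₂RingHom (algebraMap ℂ (AGerm t₀)) u) v R = 0) :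
    Q ∣ R := by
  classical
  set Θ := Polynomial.eval₂RingHom (Polynomial.eval₂RingHom (algebraMap ℂ (AGerm t₀)) u) v with hΘ
  have hΘC : ∀ r : ℂ[X], Θ (Polynomial.C r) = Polynomial.aeval u r := by
    intro r
    rw [hΘ, Polynomial.coe_eval₂RingHom, Polynomial.eval₂_C, Polynomial.coe_eval₂RingHom,
      ← Polynomial.aeval_def]
  have hprim : Q.IsPrimitive := hQirr.isPrimitive hQ1
  have hQk : Irreducible (Q.map (algebraMap ℂ[X] (RatFunc ℂ))) :=
    (hprim.irreducible_iff_irreducible_map_fraction_map (K := RatFunc ℂ)).1 hQirr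
  by_contra hndvd
  have hndvdk : ¬ Q.map (algebraMap ℂ[X] (RatFunc ℂ)) ∣ R.map (algebraMap ℂ[X] (RatFunc ℂ)) := fun h =>
    hndvd (hprim.dvd_of_fraction_map_dvd_fraction_map h)
  obtain ⟨A, B, hAB⟩ := (hQk.coprime_iff_not_dvd).2 hndvdk
  obtain ⟨c, hc, hA⟩ := IsLocalization.integerNormalization_spec (nonZeroDivisors ℂ[X]) A
  obtain ⟨d, hd, hB⟩ := IsLocalization.integerNormalization_spec (nonZeroDivisors ℂ[X]) B
  set A₀ := IsLocalization.integerNormalization (nonZeroDivisors ℂ[X]) A with hA₀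
  set B₀ := IsLocalization.integerNormalization (nonZeroDivisors ℂ[X]) B with hB₀
  have hc0 : c ≠ 0 := nonZeroDivisors.ne_zero hc
  have hd0 : d ≠ 0 := nonZeroDivisors.ne_zero hd
  have hinj : Function.Injective (algebraMap ℂ[X] (RatFunc ℂ)) := IsFractionRing.injective _ _
  have hid : Polynomial.C d * A₀ * Q + Polynomial.C c * B₀ * R = Polynomial.C (c * d) := by
    apply Polynomial.map_injective (algebraMap ℂ[X] (RatFunc ℂ)) hinj
    rw [Polynomial.map_add, Polynomial.map_mul, Polynomial.map_mul, Polynomial.map_mul,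
      Polynomial.map_mul, Polynomial.map_C, Polynomial.map_C, Polynomial.map_C, hA, hB,
      Algebra.smul_def, Algebra.smul_def, Polynomial.algebraMap_apply, Polynomial.algebraMap_apply,
      map_mul, Polynomial.C_mul]
    linear_combination (Polynomial.C (algebraMap ℂ[X] (RatFunc ℂ) c) *
      Polynomial.C (algebraMap ℂ[X] (RatFunc ℂ) d)) * hAB
  have h := congrArg Θ hid
  simp only [map_add, map_mul, hQ, hR, mul_zero, add_zero, hΘC] at h
  rw [← map_mul] at h
  exact hu ⟨c * d, mul_ne_zero hc0 hd0, h.symm⟩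

/-- Along a parametrised branch: if `Q(γ t, η t) = 0` near `t₀` for an irreducible `Q` of positive
`t`-degree and `γ` is not locally constant, then `R(γ t, η t) = 0` near `t₀` iff `Q ∣ R`.
[folklore] -/
theorem evalPP₂_eventually_eq_zero_iff_dvd {t₀ : ℂ} {γ η : ℂ → ℂ} (hγ : AnalyticAt ℂ γ t₀)
    (hη : AnalyticAt ℂ η t₀) (hγ' : ∀ᶠ t in 𝓝[≠] t₀, deriv γ t ≠ 0) {Q : ℂ[X][X]}
    (hQirr : Irreducible Q) (hQ1 : Q.natDegree ≠ 0)
    (hQ : ∀ᶠ t in 𝓝 t₀, (Q.map (Polynomial.evalRingHom (γ t))).eval (η t) = 0) (R : ℂ[X][X]) :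
    (∀ᶠ t in 𝓝 t₀, (R.map (Polynomial.evalRingHom (γ t))).eval (η t) = 0) ↔ Q ∣ R := by
  constructor
  · intro hR
    exact dvd_of_eval₂Germ_eq_zero (transcendental_mk_of_deriv_ne_zero hγ hγ') hQirr hQ1
      ((eval₂Germ_mk_eq_zero_iff hγ hη Q).2 hQ) ((eval₂Germ_mk_eq_zero_iff hγ hη R).2 hR)
  · rintro ⟨S, rfl⟩
    filter_upwards [hQ] with t ht
    rw [Polynomial.map_mul, Polynomial.eval_mul, ht, zero_mul]

end Summit.Schanuel.Schanuel.Theorems
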